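import Mathlib
import HarnessLib
import Summits.NavierStokesRegularity.NavierStokesRegularity.Theorems.UnthreadedRigidityDoorUnthreadedRigidityTwoShellTopComponent
import Summits.NavierStokesRegularity.NavierStokesRegularity.Theorems.UnthreadedRigidityDoorUnthreadedRigidityVirialHornBracketTwo

/-!
# Route `UnthreadedRigidityDoor`, item `UnthreadedRigidity` (W2, stmt-NavierStokesRegularity-27585) — LINE g12-1 «CO-ZONAL» / g12-2 «PERSISTENCE»:
# TWO-SHELL SPHERE COEFFICIENTS — in a sphere relation between two solid harmonics of degrees `ℓ + 2 ≤ L`, the TOP shell's `Y²`- and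
# `|∇Y|²`-coefficients VANISH

Prover file (engine-1 g74; `--supports stmt-NavierStokesRegularity-27585 --as helper`; route-independent imports).

The read-off step of the persistence road for general two-shells (HOME engine/engine-1/RECORD-OF-CUSTODY-engine1-g73.md §3(a)), from the
top-component lemmas (`chartT_map_ne_zero`, ★ `chartT_map_dotP_ne_zero`, file `…TwoShellTopComponent`).  ★ `twoShell_sphere_coefficients`: let
`Y_T`, `Y_B` be solid harmonics of degrees `L` and `ℓ` with `1 ≤ ℓ`, `ℓ + 2 ≤ L`, `Y_T ≢ 0`, and suppose that ON THE UNIT SPHERE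

  `A_T |∇Y_T|² + B_T Y_T² + A_B |∇Y_B|² + B_B Y_B² + E_T Y_T + E_B Y_B = C`

with constants, where a linear term is only allowed on an EVEN-degree harmonic (`E_T = 0 ∨ Even L`, `E_B = 0 ∨ Even ℓ` — the shape of the
two-shell sphere relation `MixedPair.twoShell_sphere_relation`, whose `e·Y₂` term sits on the even shell).  Then `B_T = 0` as soon as `ℓ < L`,
AND `A_T = 0` as soon as `ℓ + 2 ≤ L`.
PROOF: homogenise to the degree-`2L` polynomial identity `B_T·P_T² + ρ·F₁ ≡ 0` on `ℝ³` (`F₁` carries the other five terms with the powers of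
`ρ = |x|²` that the parity hypotheses make integral; `Zonal.eq_zero_of_evalE_eq_zero`); the null-cone chart kills `ρ`, so `B_T·chartT(P_T)² = 0`,
i.e. `B_T = 0` by (T1); then `F₁ ≡ 0`, and its chart is `A_T·chartT(∇P_T·∇P_T)` (every other term of `F₁` still carries a factor `ρ` because
`ℓ ≤ L − 2`), so `A_T = 0` by (T2).  The degree gap is sharp for this argument: for `ℓ = L − 1` the `Y_B²` term enters the second chart — the
`(1,2)` coincidence resolved by the cubic law in `…MixedPairWindowRigidityHolds`.

HONEST LABEL: algebra of solid harmonics (support of a rung line); nothing here bears on `UnthreadedRigidity` (27585), the door Target, W2 or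
Navier–Stokes regularity; no summit statement is proved.  MODEL/rung work; 0 kit.  [folklore]
-/

noncomputable section

-- the summit and its single sub-problem share the name (CONVENTIONS §1), as in every Theorems file
set_option linter.dupNamespace false

namespace Summit.NavierStokesRegularity.NavierStokesRegularity.Theorems.UnthreadedRigidity.MixedPair

open MvPolynomial
open scoped Polynomial RealInnerProductSpace
open Literature.Geometry.DiscreteGeometry (norm_sq_fin3)
open Summit.NavierStokesRegularity.NavierStokesRegularity.Theorems.UnthreadedRigidity.ProfileHorn (E3)
open Summit.NavierStokesRegularity.NavierStokesRegularity.Theorems.UnthreadedRigidity.VirialHorn (IsSolidHarmonic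
  IsSolidHarmonic.exists_evalE)
open Summit.NavierStokesRegularity.NavierStokesRegularity.Theorems.PoloidalLiouville.HorizonTower.Zonal

/-! ## Small evaluation lemmas -/

/-- `ρ ≠ 0` as a real polynomial. -/
theorem normSq_real_ne_zero : (normSq : MvPolynomial (Fin 3) ℝ) ≠ 0 := by
  intro h
  have h1 := congrArg (fun p : MvPolynomial (Fin 3) ℝ => eval ![(1 : ℝ), 0, 0] p) h
  simp [normSq] at h1

/-- the chart kills every term `c · ρ^{e+1} · Q`. -/
theorem chartT_map_normSq_pow_succ_mul (c : ℝ) (e : ℕ) (Q : MvPolynomial (Fin 3) ℝ) :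
    chartT (map (algebraMap ℝ ℂ) (C c * normSq ^ (e + 1) * Q)) = 0 := by
  rw [map_mul, map_mul, map_pow, map_normSq, chartT_mul, chartT_mul, chartT_pow, chartT_normSq, zero_pow (Nat.succ_ne_zero e),
    mul_zero, zero_mul]

/-- the chart kills every term `c · ρ^{e+1}`. -/
theorem chartT_map_normSq_pow_succ (c : ℝ) (e : ℕ) :
    chartT (map (algebraMap ℝ ℂ) (C c * normSq ^ (e + 1) : MvPolynomial (Fin 3) ℝ)) = 0 := by
  rw [map_mul, map_pow, map_normSq, chartT_mul, chartT_pow, chartT_normSq, zero_pow (Nat.succ_ne_zero e), mul_zero]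

/-! ## ★ The two-shell sphere coefficients -/

/-- ★ **TWO-SHELL SPHERE COEFFICIENTS** (module docstring): in a constant-coefficient sphere relation between the squares, gradient squares and
(even-degree) linear terms of two solid harmonics of degrees `ℓ < L` (`1 ≤ ℓ`, the top one nonzero), the coefficient of `Y_T²` vanishes, and so
does the coefficient of `|∇Y_T|²` when `ℓ + 2 ≤ L`. -/
theorem twoShell_sphere_coefficients {L ℓ : ℕ} (hℓ : 1 ≤ ℓ) (hlt : ℓ + 1 ≤ L) {Y_T Y_B : E3 → ℝ}
    (hT : IsSolidHarmonic L Y_T) (hB : IsSolidHarmonic ℓ Y_B) (hT0 : ∃ y, Y_T y ≠ 0)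
    {A_T B_T A_B B_B E_T E_B C₀ : ℝ} (hET : E_T = 0 ∨ Even L) (hEB : E_B = 0 ∨ Even ℓ)
    (hrel : ∀ u : E3, ‖u‖ = 1 →
      A_T * ‖gradient Y_T u‖ ^ 2 + B_T * Y_T u ^ 2 + A_B * ‖gradient Y_B u‖ ^ 2 + B_B * Y_B u ^ 2 + E_T * Y_T u + E_B * Y_B u = C₀) :
    B_T = 0 ∧ (ℓ + 2 ≤ L → A_T = 0) := by
  obtain ⟨ℓ', rfl⟩ := Nat.exists_eq_add_of_le' hℓ
  obtain ⟨k, rfl⟩ := Nat.exists_eq_add_of_le hlt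
  -- the polynomials
  obtain ⟨PT, hPTh, hPTl, hYT⟩ := hT.exists_evalE
  obtain ⟨PB, hPBh, hPBl, hYB⟩ := hB.exists_evalE
  have hPT0 : PT ≠ 0 := by
    rintro rfl
    obtain ⟨y, hy⟩ := hT0
    exact hy (by rw [hYT]; simp [evalE])
  -- exponents of `ρ` in front of the linear terms (integral by the parity hypotheses)
  set eT : ℕ := (ℓ' + 1 + 1 + k) / 2 - 1 with heT
  set eB : ℕ := (ℓ' + 3 + 2 * k) / 2 - 1 with heB
  -- the homogenised relation `B_T P_T² + ρ F₁`
  set F₁ : MvPolynomial (Fin 3) ℝ := C A_T * dotP PT PT + C A_B * normSq ^ (k + 1) * dotP PB PB + C B_B * normSq ^ k * (PB * PB)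
    + C E_T * normSq ^ eT * PT + C E_B * normSq ^ eB * PB - C C₀ * normSq ^ (ℓ' + 1 + k) with hF₁
  have hρ : ∀ y : E3, evalE normSq y = ‖y‖ ^ 2 := fun y => by rw [norm_sq_fin3]; simp [normSq, evalE]
  have hgradT : ∀ y : E3, evalE (dotP PT PT) y = ‖gradient Y_T y‖ ^ 2 := fun y => by
    rw [hYT]; exact (congrFun (norm_gradient_sq_evalE PT) y).symm
  have hgradB : ∀ y : E3, evalE (dotP PB PB) y = ‖gradient Y_B y‖ ^ 2 := fun y => by
    rw [hYB]; exact (congrFun (norm_gradient_sq_evalE PB) y).symm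
  have hevPT : ∀ y : E3, evalE PT y = Y_T y := fun y => by rw [hYT]
  have hevPB : ∀ y : E3, evalE PB y = Y_B y := fun y => by rw [hYB]
  have hpow : ∀ (p : MvPolynomial (Fin 3) ℝ) (n : ℕ) (y : E3), evalE (p ^ n) y = evalE p y ^ n := fun p n y => by
    simp [evalE, map_pow]
  -- evaluation of `F₁` and of the relation polynomial
  have hF₁ev : ∀ y : E3, evalE F₁ y = A_T * ‖gradient Y_T y‖ ^ 2 + A_B * (‖y‖ ^ 2) ^ (k + 1) * ‖gradient Y_B y‖ ^ 2
      + B_B * (‖y‖ ^ 2) ^ k * Y_B y ^ 2 + E_T * (‖y‖ ^ 2) ^ eT * Y_T y + E_B * (‖y‖ ^ 2) ^ eB * Y_B y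
      - C₀ * (‖y‖ ^ 2) ^ (ℓ' + 1 + k) := by
    intro y
    simp only [hF₁, evalE_add, evalE_sub, evalE_mul, evalE_C, hpow, hρ, hgradT, hgradB, hevPT, hevPB]
    ring
  have hzero : ∀ y : E3, evalE (C B_T * (PT * PT) + normSq * F₁) y = 0 := by
    intro y
    rw [evalE_add, evalE_mul, evalE_mul, evalE_C, evalE_mul, hρ, hF₁ev, hevPT]
    by_cases hy : y = 0
    · -- at the origin every term vanishes (`Y_T(0) = 0`, `ρ(0) = 0`)
      have hYT0 : Y_T 0 = 0 := by
        have h := hT.apply_smul 0 (0 : E3)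
        rw [zero_smul, zero_pow (by omega), zero_mul] at h
        exact h
      rw [hy, hYT0, norm_zero]
      ring
    · -- off the origin: `y = r • u`, homogeneity of `Y`, `∇Y`
      have hr : 0 < ‖y‖ := norm_pos_iff.2 hy
      set r : ℝ := ‖y‖ with hr_def
      set u : E3 := r⁻¹ • y with hu_def
      have hu : ‖u‖ = 1 := by rw [hu_def, norm_smul, norm_inv, norm_norm, inv_mul_cancel₀ hr.ne']
      have hyu : y = r • u := by rw [hu_def, smul_smul, mul_inv_cancel₀ hr.ne', one_smul]
      have hYTs : Y_T y = r ^ (ℓ' + 1 + 1 + k) * Y_T u := by rw [hyu, hT.apply_smul]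
      have hYBs : Y_B y = r ^ (ℓ' + 1) * Y_B u := by rw [hyu, hB.apply_smul]
      have hGTs : ‖gradient Y_T y‖ ^ 2 = (r ^ (ℓ' + 1 + k)) ^ 2 * ‖gradient Y_T u‖ ^ 2 := by
        rw [hyu, hT.gradient_smul r hr u, norm_smul, mul_pow, Real.norm_eq_abs, sq_abs,
          show ((ℓ' + 1 + 1 + k : ℕ) : ℤ) - 1 = ((ℓ' + 1 + k : ℕ) : ℤ) by push_cast; ring, zpow_natCast]
      have hGBs : ‖gradient Y_B y‖ ^ 2 = (r ^ ℓ') ^ 2 * ‖gradient Y_B u‖ ^ 2 := by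
        rw [hyu, hB.gradient_smul r hr u, norm_smul, mul_pow, Real.norm_eq_abs, sq_abs,
          show ((ℓ' + 1 : ℕ) : ℤ) - 1 = ((ℓ' : ℕ) : ℤ) by push_cast; ring, zpow_natCast]
      -- the two linear terms, with the parity bookkeeping
      have hTlin : E_T * (r ^ 2) ^ eT * (r ^ (ℓ' + 1 + 1 + k) * Y_T u) = r ^ (2 * ℓ' + 2 + 2 * k) * (E_T * Y_T u) := by
        rcases hET with h | ⟨j, hj⟩
        · rw [h]; ring
        · have e1 : (r ^ 2) ^ eT * r ^ (ℓ' + 1 + 1 + k) = r ^ (2 * ℓ' + 2 + 2 * k) := by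
            rw [← pow_mul, ← pow_add]; congr 1; omega
          rw [← e1]; ring
      have hBlin : E_B * (r ^ 2) ^ eB * (r ^ (ℓ' + 1) * Y_B u) = r ^ (2 * ℓ' + 2 + 2 * k) * (E_B * Y_B u) := by
        rcases hEB with h | ⟨i, hi⟩
        · rw [h]; ring
        · have e1 : (r ^ 2) ^ eB * r ^ (ℓ' + 1) = r ^ (2 * ℓ' + 2 + 2 * k) := by
            rw [← pow_mul, ← pow_add]; congr 1; omega
          rw [← e1]; ring
      have key := hrel u hu
      rw [hYTs, hYBs, hGTs, hGBs]
      have htot : B_T * (r ^ (ℓ' + 1 + 1 + k) * Y_T u * (r ^ (ℓ' + 1 + 1 + k) * Y_T u)) +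
          r ^ 2 * (A_T * ((r ^ (ℓ' + 1 + k)) ^ 2 * ‖gradient Y_T u‖ ^ 2) + A_B * (r ^ 2) ^ (k + 1) * ((r ^ ℓ') ^ 2 * ‖gradient Y_B u‖ ^ 2)
            + B_B * (r ^ 2) ^ k * (r ^ (ℓ' + 1) * Y_B u) ^ 2 + E_T * (r ^ 2) ^ eT * (r ^ (ℓ' + 1 + 1 + k) * Y_T u)
            + E_B * (r ^ 2) ^ eB * (r ^ (ℓ' + 1) * Y_B u) - C₀ * (r ^ 2) ^ (ℓ' + 1 + k))
          = r ^ 2 * r ^ (2 * ℓ' + 2 + 2 * k) *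
            (A_T * ‖gradient Y_T u‖ ^ 2 + B_T * Y_T u ^ 2 + A_B * ‖gradient Y_B u‖ ^ 2 + B_B * Y_B u ^ 2 + E_T * Y_T u + E_B * Y_B u - C₀) := by
        rw [hTlin, hBlin]; ring
      rw [htot, key, sub_self, mul_zero]
  have hFz : C B_T * (PT * PT) + normSq * F₁ = 0 := eq_zero_of_evalE_eq_zero hzero
  -- FIRST CHART: `B_T chartT(P_T)² = 0`
  have hBT : B_T = 0 := by
    have h1 := congrArg (fun G : MvPolynomial (Fin 3) ℝ => chartT (map (algebraMap ℝ ℂ) G)) hFz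
    simp only [map_add, map_mul, map_C, map_zero, chartT_add, chartT_mul, chartT_C, chartT_zero, map_normSq, chartT_normSq,
      zero_mul, add_zero] at h1
    rcases mul_eq_zero.mp h1 with h | h
    · have h2 : (algebraMap ℝ ℂ) B_T = 0 := Polynomial.C_eq_zero.mp h
      exact (map_eq_zero_iff (algebraMap ℝ ℂ) (algebraMap ℝ ℂ).injective).mp h2
    · exact absurd (mul_self_eq_zero.mp h) (chartT_map_ne_zero hPTh hPTl hPT0)
  -- hence `F₁ = 0`
  have hF1z : F₁ = 0 := by
    rw [hBT, C_0, zero_mul, zero_add] at hFz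
    exact (mul_eq_zero.mp hFz).resolve_left normSq_real_ne_zero
  -- SECOND CHART (degree gap `≥ 2`, i.e. `k = k' + 1`): `A_T chartT(∇P_T·∇P_T) = 0`
  refine ⟨hBT, fun hgap => ?_⟩
  obtain ⟨k', rfl⟩ : ∃ k', k = k' + 1 := ⟨k - 1, by omega⟩
  have hTterm : chartT (map (algebraMap ℝ ℂ) (C E_T * normSq ^ eT * PT)) = 0 := by
    rcases hET with h | ⟨j, hj⟩
    · rw [h, C_0, zero_mul, zero_mul, map_zero, chartT_zero]
    · obtain ⟨e, he⟩ : ∃ e, eT = e + 1 := ⟨eT - 1, by omega⟩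
      rw [he]; exact chartT_map_normSq_pow_succ_mul E_T e PT
  have hBterm : chartT (map (algebraMap ℝ ℂ) (C E_B * normSq ^ eB * PB)) = 0 := by
    obtain ⟨e, he⟩ : ∃ e, eB = e + 1 := ⟨eB - 1, by omega⟩
    rw [he]; exact chartT_map_normSq_pow_succ_mul E_B e PB
  have h2 := congrArg (fun G : MvPolynomial (Fin 3) ℝ => chartT (map (algebraMap ℝ ℂ) G)) hF1z
  simp only [hF₁] at h2
  rw [map_zero, chartT_zero, map_sub, map_add, map_add, map_add, map_add, chartT_sub, chartT_add, chartT_add, chartT_add, chartT_add,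
    hTterm, hBterm, show k' + 1 + 1 = (k' + 1) + 1 by ring, chartT_map_normSq_pow_succ_mul, chartT_map_normSq_pow_succ_mul,
    show ℓ' + 1 + (k' + 1) = (ℓ' + 1 + k') + 1 by ring, chartT_map_normSq_pow_succ, map_mul, map_C, chartT_mul, chartT_C] at h2
  simp only [add_zero, sub_zero] at h2
  rcases mul_eq_zero.mp h2 with h | h
  · have h3 : (algebraMap ℝ ℂ) A_T = 0 := Polynomial.C_eq_zero.mp h
    exact (map_eq_zero_iff (algebraMap ℝ ℂ) (algebraMap ℝ ℂ).injective).mp h3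
  · exact absurd h (chartT_map_dotP_ne_zero' (by omega) hPTh hPTl hPT0)

end Summit.NavierStokesRegularity.NavierStokesRegularity.Theorems.UnthreadedRigidity.MixedPair

end
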